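import Summits.Ventures.HodgeRepro2.T5SU11LegendreSeriesDeriv
import Summits.Ventures.HodgeRepro2.T5SU11LegendreTuran

/-!
# The Legendre coefficients of the derivative: `c_k(f′) = (2k + 1) Σ_{j ≥ 0} c_{k+1+2j}(f)` and
`c_k(f) = c_{k−1}(f′)/(2k − 1) − c_{k+1}(f′)/(2k + 3)`

Two classical relations between the Fourier–Legendre coefficients of a function and of its derivative.

* `∫_{−1}^{1} P′_n P_k = 1 − (−1)^{n+k}` for `k < n` and `= 0` for `n ≤ k` (`integral_legQ_mul_legP`): integration
  by parts with `P_n(±1) = (±1)^n` and the orthogonality of `P_n` to the lower-degree polynomial `P′_k` (row 406).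
* For `f ∈ C¹`: `(2k + 1) P_k = P′_{k+1} − P′_{k−1}` (row 378) and one integration by parts give
  **`c_k(f) = c_{k−1}(f′)/(2k − 1) − c_{k+1}(f′)/(2k + 3)`** for `k ≥ 1` (`fourierLegendre_eq_sub_deriv`).
* For `f ∈ C⁴`: row 426's `f′ = Σ_n c_n(f) P′_n` integrated termwise against `P_k` (dominated convergence with the
  summable majorant `|c_n(f)| n(n + 1)/2`) gives **`c_k(f′) = (2k + 1) Σ_{j≥0} c_{k+1+2j}(f)`**
  (`fourierLegendre_deriv_eq_tsum`, `hasSum_fourierLegendre_deriv`): the coefficients of `f′` are the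
  odd-offset tail sums of the coefficients of `f` (the spectral differentiation matrix of the Legendre basis).

Nothing is claimed about (N).

Blind lane: Mathlib + the HodgeRepro2 prefix only; no sorry; axioms ⊆ {propext, Classical.choice,
Quot.sound}.
-/

namespace Summit.Ventures.HodgeRepro2.T5SU11LegendreDerivCoeff

open Polynomial intervalIntegral Finset Filter Topology MeasureTheory
open Set (Icc Ioc Ioo uIcc uIoc EqOn)
open T5SU11SphericalLegendreAll T5SU11SphericalLegendreLaplace T5SU11JacobiPhaseLawEven T5SU11JacobiLegendreLeading
  T5SU11LegendreIdentities T5SU11LegendreOrthogonal T5SU11LegendreOrthogonalLower T5SU11LegendreBound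
  T5SU11LegendreTuran T5SU11LegendreSeries T5SU11LegendreCoefficientDecay T5SU11LegendreSeriesUniform
  T5SU11LegendreSeriesRate T5SU11LegendreSeriesDeriv T5SU11LegendreDerivativeSum

/-! ### `∫ P′_n P_k` -/

/-- `∫_{−1}^{1} P_n P′_k = 0` for `k ≤ n` (`P′_k` has degree `< n`, or vanishes). -/
theorem integral_legP_mul_legQ_eq_zero {n k : ℕ} (h : k ≤ n) : ∫ x in (-1 : ℝ)..1, legP n x * legQ k x = 0 := by
  rcases Nat.eq_zero_or_pos k with rfl | hk
  · simp [legQ]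
  · have e : ∀ x, legQ k x = (derivative (legPoly k)).eval x := fun x => (eval_derivative_legPoly k x).symm
    simp_rw [e]
    refine integral_legP_mul_eval_eq_zero_of_natDegree_lt ?_
    calc (derivative (legPoly k)).natDegree ≤ (legPoly k).natDegree - 1 := natDegree_derivative_le _
      _ = k - 1 := by rw [natDegree_legPoly]
      _ < n := by omega

/-- **`∫_{−1}^{1} P′_n P_k = 1 − (−1)^{n+k}` for `k < n`, `= 0` for `n ≤ k`** (integration by parts). -/
theorem integral_legQ_mul_legP (n k : ℕ) :
    ∫ x in (-1 : ℝ)..1, legQ n x * legP k x = if k < n then 1 - (-1 : ℝ) ^ (n + k) else 0 := by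
  have hu : ∀ x ∈ uIcc (-1 : ℝ) 1, HasDerivAt (legP k) (legQ k x) x := fun x _ => hasDerivAt_legP k x
  have hv : ∀ x ∈ uIcc (-1 : ℝ) 1, HasDerivAt (legP n) (legQ n x) x := fun x _ => hasDerivAt_legP n x
  have hu' : IntervalIntegrable (legQ k) volume (-1 : ℝ) 1 := (continuous_legQ k).intervalIntegrable _ _
  have hv' : IntervalIntegrable (legQ n) volume (-1 : ℝ) 1 := (continuous_legQ n).intervalIntegrable _ _
  have h := integral_mul_deriv_eq_deriv_mul hu hv hu' hv'
  -- `∫ P_k P′_n = P_k(1) P_n(1) − P_k(−1) P_n(−1) − ∫ P′_k P_n`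
  rw [legP_one, legP_one, legP_neg_one, legP_neg_one] at h
  have e1 : ∫ x in (-1 : ℝ)..1, legQ n x * legP k x = ∫ x in (-1 : ℝ)..1, legP k x * legQ n x :=
    integral_congr fun x _ => mul_comm _ _
  have e2 : ∫ x in (-1 : ℝ)..1, legQ k x * legP n x = ∫ x in (-1 : ℝ)..1, legP n x * legQ k x :=
    integral_congr fun x _ => mul_comm _ _
  rw [e1]
  split_ifs with hkn
  · rw [e2, integral_legP_mul_legQ_eq_zero hkn.le] at h
    rw [h, pow_add]
    ring
  · exact integral_legP_mul_legQ_eq_zero (not_lt.mp hkn)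

/-- The parity form: `∫ P′_{k+1+2j} P_k = 2` and `∫ P′_{k+2j} P_k = 0`. -/
theorem integral_legQ_mul_legP_odd (k j : ℕ) : ∫ x in (-1 : ℝ)..1, legQ (k + 1 + 2 * j) x * legP k x = 2 := by
  rw [integral_legQ_mul_legP, if_pos (by omega)]
  have : (-1 : ℝ) ^ (k + 1 + 2 * j + k) = -1 := by
    rw [show k + 1 + 2 * j + k = 2 * (k + j) + 1 by ring, pow_succ, pow_mul]
    norm_num
  rw [this]
  norm_num

/-- `∫ P′_n P_k = 0` when `n − k` is even. -/
theorem integral_legQ_mul_legP_even (k j : ℕ) : ∫ x in (-1 : ℝ)..1, legQ (k + 2 * j) x * legP k x = 0 := by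
  rw [integral_legQ_mul_legP]
  split_ifs with h
  · have : (-1 : ℝ) ^ (k + 2 * j + k) = 1 := by
      rw [show k + 2 * j + k = 2 * (k + j) by ring, pow_mul]
      norm_num
    rw [this, sub_self]
  · rfl

/-! ### `C¹`: `c_k(f) = c_{k−1}(f′)/(2k − 1) − c_{k+1}(f′)/(2k + 3)` -/

section C1

variable {f f₁ : ℝ → ℝ} (hf : ∀ x ∈ Icc (-1 : ℝ) 1, HasDerivAt f (f₁ x) x)
  (hf₁ : ContinuousOn f₁ (Icc (-1 : ℝ) 1))
include hf hf₁

/-- `∫ f (P′_{k+2} − P′_k) = −∫ f′ (P_{k+2} − P_k)` (the boundary terms vanish: `P_{k+2}(±1) = P_k(±1)`). -/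
theorem integral_mul_legQ_sub_eq (k : ℕ) :
    ∫ x in (-1 : ℝ)..1, f x * (legQ (k + 2) x - legQ k x)
      = -∫ x in (-1 : ℝ)..1, f₁ x * (legP (k + 2) x - legP k x) := by
  have hu : ∀ x ∈ uIcc (-1 : ℝ) 1, HasDerivAt f (f₁ x) x := fun x hx =>
    hf x (by rwa [Set.uIcc_of_le (by norm_num)] at hx)
  have hv : ∀ x ∈ uIcc (-1 : ℝ) 1, HasDerivAt (fun x => legP (k + 2) x - legP k x) (legQ (k + 2) x - legQ k x) x :=
    fun x _ => (hasDerivAt_legP (k + 2) x).sub (hasDerivAt_legP k x)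
  have hu' : IntervalIntegrable f₁ volume (-1 : ℝ) 1 := hf₁.intervalIntegrable_of_Icc (by norm_num)
  have hv' : IntervalIntegrable (fun x => legQ (k + 2) x - legQ k x) volume (-1 : ℝ) 1 :=
    ((continuous_legQ (k + 2)).sub (continuous_legQ k)).intervalIntegrable _ _
  have h := integral_mul_deriv_eq_deriv_mul hu hv hu' hv'
  rw [legP_one, legP_one, legP_neg_one, legP_neg_one, sub_self, mul_zero, pow_add] at h
  norm_num at h
  rw [h]

/-- **`c_k(f) = c_{k−1}(f′)/(2k − 1) − c_{k+1}(f′)/(2k + 3)`** for `k ≥ 1` and `f ∈ C¹` (`(2k + 1) P_k = P′_{k+1} −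
P′_{k−1}`, row 378, and one integration by parts). -/
theorem fourierLegendre_eq_sub_deriv {k : ℕ} (hk : 1 ≤ k) :
    fourierLegendre f k
      = fourierLegendre f₁ (k - 1) / (2 * (k : ℝ) - 1) - fourierLegendre f₁ (k + 1) / (2 * (k : ℝ) + 3) := by
  obtain ⟨m, rfl⟩ : ∃ m, k = m + 1 := ⟨k - 1, by omega⟩
  simp only [Nat.add_sub_cancel]
  have hfc : ContinuousOn f (Icc (-1 : ℝ) 1) := fun x hx => (hf x hx).continuousAt.continuousWithinAt
  -- `(2m + 3) ∫ f P_{m+1} = ∫ f (P′_{m+2} − P′_m) = −∫ f′ (P_{m+2} − P_m)`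
  have e1 : (2 * (m : ℝ) + 3) * ∫ x in (-1 : ℝ)..1, f x * legP (m + 1) x
      = ∫ x in (-1 : ℝ)..1, f x * (legQ (m + 2) x - legQ m x) := by
    rw [← intervalIntegral.integral_const_mul]
    refine integral_congr fun x _ => ?_
    rw [legQ_succ_succ_sub_legQ]
    ring
  rw [integral_mul_legQ_sub_eq hf hf₁] at e1
  have e2 : ∫ x in (-1 : ℝ)..1, f₁ x * (legP (m + 2) x - legP m x)
      = (∫ x in (-1 : ℝ)..1, f₁ x * legP (m + 2) x) - ∫ x in (-1 : ℝ)..1, f₁ x * legP m x := by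
    rw [← integral_sub (hf₁.intervalIntegrable_of_Icc (by norm_num) |>.mul_continuousOn
      (continuous_legP (m + 2)).continuousOn) (hf₁.intervalIntegrable_of_Icc (by norm_num) |>.mul_continuousOn
      (continuous_legP m).continuousOn)]
    refine integral_congr fun x _ => ?_
    ring
  rw [e2] at e1
  push_cast
  have h1 : (2 * ((m : ℝ) + 1) - 1) ≠ 0 := by
    have : (0 : ℝ) ≤ m := Nat.cast_nonneg m
    linarith
  have h1' : (2 * ((m : ℝ) + 1) + 3) ≠ 0 := by positivity
  have hA : fourierLegendre f (m + 1) = (2 * (m : ℝ) + 3) / 2 * ∫ x in (-1 : ℝ)..1, f x * legP (m + 1) x := by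
    simp only [fourierLegendre]
    push_cast
    ring
  have hC : fourierLegendre f₁ m / (2 * ((m : ℝ) + 1) - 1) = (∫ x in (-1 : ℝ)..1, f₁ x * legP m x) / 2 := by
    simp only [fourierLegendre]
    have h2 : (2 * (m : ℝ) + 1) ≠ 0 := by positivity
    field_simp
    ring
  have hB : fourierLegendre f₁ (m + 1 + 1) / (2 * ((m : ℝ) + 1) + 3)
      = (∫ x in (-1 : ℝ)..1, f₁ x * legP (m + 2) x) / 2 := by
    simp only [fourierLegendre]
    push_cast
    have h2 : (2 * ((m : ℝ) + 1 + 1) + 1) ≠ 0 := by positivity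
    field_simp
    ring
  rw [hA, hC, hB]
  linear_combination (1 / 2 : ℝ) * e1

end C1

/-! ### `C⁴`: `c_k(f′) = (2k + 1) Σ_j c_{k+1+2j}(f)` -/

section C4

variable {f f₁ f₂ f₃ f₄ : ℝ → ℝ}
  (h₁ : ∀ x ∈ Icc (-1 : ℝ) 1, HasDerivAt f (f₁ x) x)
  (h₂ : ∀ x ∈ Icc (-1 : ℝ) 1, HasDerivAt f₁ (f₂ x) x)
  (h₃ : ∀ x ∈ Icc (-1 : ℝ) 1, HasDerivAt f₂ (f₃ x) x)
  (h₄ : ∀ x ∈ Icc (-1 : ℝ) 1, HasDerivAt f₃ (f₄ x) x)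
  (h₄c : ContinuousOn f₄ (Icc (-1 : ℝ) 1))
include h₁ h₂ h₃ h₄ h₄c

/-- **Termwise integration**: `∫ f′ P_k = Σ_n c_n(f) ∫ P′_n P_k` (dominated convergence with the majorant
`|c_n(f)| n(n + 1)/2` of row 426). -/
theorem hasSum_integral_legQ_mul_legP (k : ℕ) :
    HasSum (fun n => fourierLegendre f n * ∫ x in (-1 : ℝ)..1, legQ n x * legP k x)
      (∫ x in (-1 : ℝ)..1, f₁ x * legP k x) := by
  have hmaj := summable_abs_fourierLegendre_mul_deriv_bound h₁ h₂ h₃ h₄ h₄c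
  have h := intervalIntegral.hasSum_integral_of_dominated_convergence (μ := volume) (a := (-1 : ℝ)) (b := 1)
    (F := fun n t => fourierLegendre f n * legQ n t * legP k t) (f := fun t => f₁ t * legP k t)
    (fun n _ => |fourierLegendre f n| * ((n : ℝ) * (n + 1) / 2))
    (fun n => ((continuous_const.mul (continuous_legQ n)).mul (continuous_legP k)).aestronglyMeasurable)
    (fun n => Filter.Eventually.of_forall fun t ht => ?_)
    (Filter.Eventually.of_forall fun _ _ => hmaj)
    intervalIntegrable_const
    (Filter.Eventually.of_forall fun t ht => ?_)
  · refine h.congr_fun fun n => ?_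
    rw [← intervalIntegral.integral_const_mul]
    refine integral_congr fun x _ => ?_
    ring
  · have ht' : t ∈ Icc (-1 : ℝ) 1 := by
      rw [Set.uIoc_of_le (by norm_num)] at ht
      exact Set.Ioc_subset_Icc_self ht
    rw [Real.norm_eq_abs, abs_mul, abs_mul]
    calc |fourierLegendre f n| * |legQ n t| * |legP k t|
        ≤ |fourierLegendre f n| * ((n : ℝ) * (n + 1) / 2) * 1 := by
          gcongr
          · exact abs_legQ_le n ht'
          · exact abs_legP_le_one k ht'
      _ = _ := mul_one _
  · have ht' : t ∈ Icc (-1 : ℝ) 1 := by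
      rw [Set.uIoc_of_le (by norm_num)] at ht
      exact Set.Ioc_subset_Icc_self ht
    exact (hasSum_fourierLegendre_mul_legQ h₁ h₂ h₃ h₄ h₄c ht').mul_right (legP k t)

/-- **`Σ_{j≥0} 2 c_{k+1+2j}(f) = ∫ f′ P_k`**: only the odd offsets survive. -/
theorem hasSum_two_mul_fourierLegendre_odd (k : ℕ) :
    HasSum (fun j => 2 * fourierLegendre f (k + 1 + 2 * j)) (∫ x in (-1 : ℝ)..1, f₁ x * legP k x) := by
  have h := hasSum_integral_legQ_mul_legP h₁ h₂ h₃ h₄ h₄c k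
  have hg : Function.Injective (fun j : ℕ => k + 1 + 2 * j) := fun a b hab => by simpa using hab
  rw [← hg.hasSum_iff] at h
  · refine h.congr_fun fun j => ?_
    simp only [Function.comp]
    rw [integral_legQ_mul_legP_odd, mul_comm]
  · intro n hn
    simp only [Set.mem_range, not_exists] at hn
    rw [integral_legQ_mul_legP]
    split_ifs with hkn
    · -- `k < n` and `n` is not `k + 1 + 2j`: `n + k` is even
      rcases Nat.even_or_odd (n + k) with he | ho
      · rw [he.neg_one_pow, sub_self, mul_zero]
      · exfalso
        obtain ⟨m, hm⟩ := ho
        exact hn (m - k) (by omega)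
    · exact mul_zero _

/-- **`c_k(f′) = (2k + 1) Σ_{j≥0} c_{k+1+2j}(f)`** for `f ∈ C⁴`: the Legendre coefficients of the derivative are
the odd-offset tail sums of the coefficients of `f`. -/
theorem fourierLegendre_deriv_eq_tsum (k : ℕ) :
    fourierLegendre f₁ k = (2 * (k : ℝ) + 1) * ∑' j, fourierLegendre f (k + 1 + 2 * j) := by
  have h := (hasSum_two_mul_fourierLegendre_odd h₁ h₂ h₃ h₄ h₄c k).tsum_eq
  rw [tsum_mul_left] at h
  rw [fourierLegendre, ← h]
  ring

/-- The same as a `HasSum` statement: `Σ_{j≥0} (2k + 1) c_{k+1+2j}(f) = c_k(f′)`. -/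
theorem hasSum_fourierLegendre_deriv (k : ℕ) :
    HasSum (fun j => (2 * (k : ℝ) + 1) * fourierLegendre f (k + 1 + 2 * j)) (fourierLegendre f₁ k) := by
  have h := (hasSum_two_mul_fourierLegendre_odd h₁ h₂ h₃ h₄ h₄c k).mul_left ((2 * (k : ℝ) + 1) / 2)
  rw [fourierLegendre]
  refine h.congr_fun fun j => ?_
  ring

end C4

end Summit.Ventures.HodgeRepro2.T5SU11LegendreDerivCoeff
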